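import Summits.MatrixMultiplication.MatrixMultiplication.Theorems.ObstructionDescentCountingEquations

/-!
# Counting equations, row two: at the cells of `E` the initial degree of `I(σ_m)` lies in `(m, m²]`
(decomp-mm · lens 3 · gen 18, fourth kernel)

Route `route-MatrixMultiplication-ObstructionDescent` (`ω(ℂ) = 2`), item `E = NoPolyDegreeObstruction` (30889), whose rows
are indexed by `c : ℕ` (equations of `σ_m` of degree `≤ m^c`) and whose cells are `n² ≤ m`, `n^τ ≤ m` (`τ > 2`, `n` large).
`ObstructionDescentCountingEquations.rows_contentful` made the rows `c ≥ 3` contentful at every corner cell `n² ≤ m ≤ n³`.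
Here the arithmetic is pushed to ROW TWO at the cells of `E`: the counting bound `16·3mn²·(log₂(3mn²)+3)` is
`≤ 240·n²·(log₂ n + 2)·m ≤ m²` as soon as `m ≥ 240·n²·(log₂ n + 2)` (`exists_mem_RV_corner_row_two`), and every cell
`m ≥ n^τ`, `τ > 2`, satisfies this for `n ≥ n₁(τ)` (`rows_contentful_two_rpow`, real exponent, via `log x = o(x^δ)`).
With row one EMPTY (`ObstructionDescentTorusLaws.eq_zero_of_totalDegree_le`: no equation of degree `≤ m`), the degree
profile of `E` is: rows `c ≤ 1` vacuous, rows `c ≥ 2` contentful at every cell of `E` below `n³` — there is no vacuous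
row beyond R1.  No proposition is defined; sorry-free; standard axioms.  Nothing here proves `ω = 2`.
[cite: KumarVolk2022, Lemma 9 / Theorem 10 (arXiv:2003.12938 p. 7); BurgisserClausenShokrollahi1997, §20.5; LandsbergGCT2017, §8.3.4]
-/

set_option linter.dupNamespace false
set_option autoImplicit false

noncomputable section

open scoped BigOperators

namespace Summit.MatrixMultiplication.MatrixMultiplication.Theorems.ObstructionDescentRowTwo

open Summit.MatrixMultiplication.MatrixMultiplication.Theorems.ObstructionDescentTorusLaws (RV)
open Summit.MatrixMultiplication.MatrixMultiplication.Theorems.ObstructionDescentCountingEquations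
  (exists_mem_RV_corner_ne_zero_of_room room_of_le_cube)

/-! ## §1 Row two at wide cells (natural-number arithmetic) -/

/-- `log₂(3·m·n²) ≤ 5·log₂ n + 6` at corner cells `m ≤ n³`. [bookkeeping] -/
theorem log_param_le {n m : ℕ} (hm : m ≤ n * n * n) :
    Nat.log 2 (3 * (m * (n * n))) ≤ 5 * Nat.log 2 n + 6 := by
  set ℓ := Nat.log 2 n with hℓdef
  have hn2 : n < 2 ^ (ℓ + 1) := Nat.lt_pow_succ_log_self (by norm_num) n
  have h5 : n ^ 5 < (2 ^ (ℓ + 1)) ^ 5 := Nat.pow_lt_pow_left hn2 (by norm_num)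
  rw [← pow_mul] at h5
  have hX : m * (n * n) ≤ n ^ 5 := by
    calc m * (n * n) ≤ (n * n * n) * (n * n) := Nat.mul_le_mul_right _ hm
      _ = n ^ 5 := by ring
  have hpow : 2 ^ (5 * ℓ + 7) = 4 * 2 ^ ((ℓ + 1) * 5) := by
    rw [show 5 * ℓ + 7 = 2 + (ℓ + 1) * 5 by ring, pow_add]; norm_num
  have hlt : 3 * (m * (n * n)) < 2 ^ (5 * ℓ + 7) := by rw [hpow]; omega
  rcases Nat.eq_zero_or_pos (3 * (m * (n * n))) with h0 | hpos
  · rw [h0, Nat.log_zero_right]; exact Nat.zero_le _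
  · have := Nat.log_lt_of_lt_pow hpos.ne' hlt
    omega

/-- **Row two at wide cells**: for `n ≥ 2^13`, `n² ≤ m ≤ n³` and `m ≥ 240·n²·(log₂ n + 2)` there is a non-zero equation of
`σ_m((ℂ^{n²})^{⊗3})` of degree in `(m, m²]`. [cite: KumarVolk2022, Theorem 10 (arXiv p. 7)] -/
theorem exists_mem_RV_corner_row_two {n m : ℕ} (hn : 2 ^ 13 ≤ n) (hcell : n * n ≤ m) (hm : m ≤ n * n * n)
    (hwide : 240 * (n * n) * (Nat.log 2 n + 2) ≤ m) :
    ∃ f ∈ RV (Fin n × Fin n) (Fin n × Fin n) (Fin n × Fin n) m, f ≠ 0 ∧ m < f.totalDegree ∧ f.totalDegree ≤ m ^ 2 := by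
  have hn1 : 1 ≤ n := le_trans (Nat.one_le_two_pow) hn
  have hm0 : 0 < m := lt_of_lt_of_le (Nat.mul_pos hn1 hn1) hcell
  obtain ⟨hroom, -⟩ := room_of_le_cube hn hcell hm
  obtain ⟨f, hf, hf0, hlow, hle⟩ := exists_mem_RV_corner_ne_zero_of_room hm0 hn1 hroom
  refine ⟨f, hf, hf0, hlow, hle.trans ?_⟩
  have hlog := log_param_le hm
  set ℓ := Nat.log 2 n
  set X := m * (n * n) with hXdef
  calc 16 * ((3 * X) * (Nat.log 2 (3 * X) + 3))
      ≤ 16 * ((3 * X) * (5 * ℓ + 9)) := Nat.mul_le_mul_left _ (Nat.mul_le_mul_left _ (by omega))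
    _ ≤ (240 * (n * n) * (ℓ + 2)) * m := by rw [hXdef]; nlinarith [Nat.zero_le (m * (n * n)), Nat.zero_le ℓ]
    _ ≤ m * m := Nat.mul_le_mul_right _ hwide
    _ = m ^ 2 := (sq m).symm

/-- Row form at wide cells (`n₁ = 2^13`). [this node] -/
theorem rows_contentful_two :
    ∃ n₁ : ℕ, ∀ n m : ℕ, n₁ ≤ n → n * n ≤ m → m ≤ n * n * n → 240 * (n * n) * (Nat.log 2 n + 2) ≤ m →
      ∃ f ∈ RV (Fin n × Fin n) (Fin n × Fin n) (Fin n × Fin n) m, f ≠ 0 ∧ m < f.totalDegree ∧ f.totalDegree ≤ m ^ 2 :=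
  ⟨2 ^ 13, fun _ _ hn hcell hm hwide => exists_mem_RV_corner_row_two hn hcell hm hwide⟩

/-! ## §2 The cells of `E`: `m ≥ n^τ`, `τ > 2` (real exponent) -/

/-- Eventually `480·log x + 480 ≤ x^δ` (`δ > 0`). [bookkeeping: `log x = o(x^δ)` and `x^δ → ∞`] -/
theorem eventually_affine_log_le_rpow {δ : ℝ} (hδ : 0 < δ) :
    ∃ N : ℝ, ∀ x : ℝ, N ≤ x → 480 * Real.log x + 480 ≤ x ^ δ := by
  have h1 : ∀ᶠ x : ℝ in Filter.atTop, ‖Real.log x‖ ≤ (1 / 960) * ‖x ^ δ‖ :=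
    (isLittleO_log_rpow_atTop hδ).bound (by norm_num)
  have h2 : ∀ᶠ x : ℝ in Filter.atTop, 960 ≤ x ^ δ :=
    (tendsto_rpow_atTop hδ).eventually_ge_atTop 960
  have h3 : ∀ᶠ x : ℝ in Filter.atTop, (0 : ℝ) ≤ x := Filter.eventually_ge_atTop 0
  obtain ⟨N, hN⟩ := Filter.eventually_atTop.1 (h1.and (h2.and h3))
  refine ⟨N, fun x hx => ?_⟩
  obtain ⟨hb, hge, hx0⟩ := hN x hx
  have hxδ : 0 ≤ x ^ δ := Real.rpow_nonneg hx0 δ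
  rw [Real.norm_eq_abs, Real.norm_eq_abs, abs_of_nonneg hxδ] at hb
  have hlogle : Real.log x ≤ (1 / 960) * x ^ δ := (le_abs_self _).trans hb
  nlinarith

/-- **Row two of `E` is contentful at every cell of `E` below `n³`**: for every `τ > 2` there is `n₁` such that for all
`n ≥ n₁` and all `m` with `n² ≤ m ≤ n³` and `n^τ ≤ m` there is a non-zero equation of `σ_m((ℂ^{n²})^{⊗3})` of degree in
`(m, m²]`.  With R1 (no equation of degree `≤ m`) the initial degree of `I(σ_m)` at the cells of `E` lies in `(m, m²]`.
[cite: KumarVolk2022, Theorem 10 (arXiv p. 7); LandsbergGCT2017, Prop. 8.3.4.2] -/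
theorem rows_contentful_two_rpow (τ : ℝ) (hτ : 2 < τ) :
    ∃ n₁ : ℕ, ∀ n m : ℕ, n₁ ≤ n → n * n ≤ m → m ≤ n * n * n → (n : ℝ) ^ τ ≤ (m : ℝ) →
      ∃ f ∈ RV (Fin n × Fin n) (Fin n × Fin n) (Fin n × Fin n) m, f ≠ 0 ∧ m < f.totalDegree ∧ f.totalDegree ≤ m ^ 2 := by
  have hδ : 0 < τ - 2 := by linarith
  obtain ⟨N, hN⟩ := eventually_affine_log_le_rpow hδ
  refine ⟨max (2 ^ 13) ⌈N⌉₊, fun n m hn hcell hm hτm => ?_⟩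
  have hn13 : 2 ^ 13 ≤ n := le_trans (le_max_left _ _) hn
  have hnN : N ≤ (n : ℝ) := le_trans (Nat.le_ceil N) (by exact_mod_cast le_trans (le_max_right _ _) hn)
  have hn1 : 1 ≤ n := le_trans Nat.one_le_two_pow hn13
  have hnpos : (0 : ℝ) < n := by exact_mod_cast hn1
  refine exists_mem_RV_corner_row_two hn13 hcell hm ?_
  -- the wide-cell hypothesis from `n^τ ≤ m`
  have hlogn : 0 ≤ Real.log n := Real.log_nonneg (by exact_mod_cast hn1)
  -- `log₂ n ≤ 2·log n` (the tree has this as `Literature.Computability.Complexity.natLog_two_le_two_mul_log`;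
  -- re-derived inline to keep this module's imports inside the route's cone)
  have hL : (Nat.log 2 n : ℝ) ≤ 2 * Real.log n := by
    have hpow : ((2 : ℕ) ^ Nat.log 2 n : ℕ) ≤ n := Nat.pow_log_le_self 2 (by omega)
    have hcast : (2 : ℝ) ^ Nat.log 2 n ≤ (n : ℝ) := by exact_mod_cast hpow
    have hlog : (Nat.log 2 n : ℝ) * Real.log 2 ≤ Real.log n := by
      have := Real.log_le_log (by positivity) hcast
      rwa [Real.log_pow] at this
    have h2 : (1 / 2 : ℝ) < Real.log 2 := by
      have := Real.log_two_gt_d9; norm_num at this ⊢; linarith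
    have hL0 : 0 ≤ (Nat.log 2 n : ℝ) := Nat.cast_nonneg _
    nlinarith
  have hkey : 480 * Real.log n + 480 ≤ (n : ℝ) ^ (τ - 2) := hN n hnN
  have hsplit : (n : ℝ) ^ τ = (n : ℝ) ^ (2 : ℝ) * (n : ℝ) ^ (τ - 2) := by
    rw [← Real.rpow_add hnpos]; ring_nf
  have hsq : (n : ℝ) ^ (2 : ℝ) = (n : ℝ) * n := by rw [Real.rpow_two, sq]
  have hreal : ((240 * (n * n) * (Nat.log 2 n + 2) : ℕ) : ℝ) ≤ (m : ℝ) := by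
    push_cast
    calc (240 : ℝ) * (n * n) * (Nat.log 2 n + 2) ≤ (n * n) * (480 * Real.log n + 480) := by nlinarith
      _ ≤ (n * n) * (n : ℝ) ^ (τ - 2) := mul_le_mul_of_nonneg_left hkey (by positivity)
      _ = (n : ℝ) ^ τ := by rw [hsplit, hsq]
      _ ≤ m := hτm
  exact_mod_cast hreal

end Summit.MatrixMultiplication.MatrixMultiplication.Theorems.ObstructionDescentRowTwo

end
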